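import Literature.Computability.Cryptography.GGMHybridGames
import Literature.Computability.Complexity.BrickAlgebra
import HarnessLib

/-!
# The GGM hybrid argument, III: the distinguisher, specified

Topic `Literature/Computability/Cryptography`; third companion file of `GGM.lean` towards the
discharge of `Literature.Computability.Cryptography.GGM1986_thm3`. Goldreich's algorithm `D`
(2001, proof of Thm. 3.6.6, p. 188) / GGM's string test `A_T` (1986, p. 801), folded with the
multi-sample hybrid of Thm. 3.2.6 into ONE single-sample distinguisher for the generator `G`, is
specified here as a plain function of its deterministic input `w = ⟨⟨1ⁿ, sample⟩, coins⟩` — no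
machine yet (`GGMSimulator.lean` proves that the language it decides is in `P`, whence `D` is PPT;
`GGMProofs.lean` computes its acceptance probabilities from `GGMHybridGames.lean`):

* the parse of `w` (`nOf`, `sOf`, `rAOf`, `aBitsOf`, `bBitsOf`, `rFOf`, `iOf`, `jOf`, `xAOf`): the
  coins are `coins = r_A ‖ a ‖ b ‖ r_F` — the adversary's own coins `r_A` (`coins(n)` of them),
  `α = ⌊log₂ n⌋ + 1` bits `a` for the level `i = ⟦a⟧`, `β = ⌊log₂ t⌋ + 1` bits `b` for the slot
  `j = ⟦b⟧` (`t = fuel(n)` rounds), and `2n·t` bits `r_F` read as `t` blocks of `2n` bits (`blkL`);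
* `valL G n j s r_F m` — the value handed to the level-`i` vertex first met at round `m`: block
  `m` for `m < j`, the challenge sample `s` for `m = j`, `G(block m ↾ n)` for `m > j`
  (Goldreich's "the `i`th new prefix gets the `i`th input string", with the strings before the
  checkpoint slot uniform and those after it pseudorandom — the hybrid of Thm. 3.2.6 inlined);
* `simRule 𝒜 G w` — the answer rule of the simulation (the round-indexed lazy rule of
  `GGMHybridRuns.lean` at level `i` with these values), `simLang 𝒜 G` — the words on which the
  adversary, so simulated for `fuel(n)` rounds, outputs `1`; `simAccept` adds the guard
  `i < n ∧ j < t`; `GGMHyb.distinguisher 𝒜 G : RandAlg (List Bool) Bool` is `D`, with coin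
  budget `coinLenD`;
* PROVED: the parse of a genuine input (`nOf_genuine`, …), and the bridge to the vector-valued
  pools of `GGMHybridGames.lean`: on a genuine input the simulated run is the lazy run
  `lazyRunPair` with pool `poolU` (uniform sample, `runRule_simRule_eq_poolU`) resp. `poolG`
  (sample `G σ`, `runRule_simRule_eq_poolG`).

## References

* O. Goldreich, *Foundations of Cryptography I*, CUP 2001, proof of Thm. 3.6.6 (algorithm `D`,
  p. 188) and Thm. 3.2.6 (hybrids over samples, p. 140).
* O. Goldreich, S. Goldwasser, S. Micali, J. ACM 33 (1986), p. 801 (the test `A_T`).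
-/

namespace Literature.Computability.Cryptography

open _root_.Computability Complexity Complexity.OracleAlg Complexity.Brick

namespace GGMHyb

variable (𝒜 : OracleAdversary Bool) (G : List Bool → List Bool)

/-! ### Parsing the deterministic input `w = ⟨⟨1ⁿ, s⟩, r⟩` -/

/-- The security parameter `n = |1ⁿ|`. [Goldreich 2001, p. 188] [folklore] -/
def nOf (w : List Bool) : ℕ := (fstF (fstF w)).length

/-- The challenge sample `s`, read up to `2n` symbols (a `2n`-bit string in the game; the
truncation only bounds the simulated answers on ill-formed inputs). [Goldreich 2001, p. 188] [folklore] -/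
def sOf (w : List Bool) : List Bool := (sndF (fstF w)).take (2 * nOf w)

/-- The number of level bits, `α = ⌊log₂ n⌋ + 1` (so that `n ≤ 2^α ≤ 2n` for `n ≥ 1`). [folklore] -/
def alphaOf (n : ℕ) : ℕ := Nat.log 2 n + 1

/-- The number of slot bits, `β = ⌊log₂ t⌋ + 1`. [folklore] -/
def betaOf (t : ℕ) : ℕ := Nat.log 2 t + 1

/-- The adversary's round budget `t = fuel(n)` on `1ⁿ`. [Goldreich 2001, p. 188 (`t(n)`)] [folklore] -/
def tA (n : ℕ) : ℕ := 𝒜.fuel.eval n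

/-- The adversary's coin budget on `1ⁿ`. [Goldreich 2001, §1.3] [folklore] -/
def cA (n : ℕ) : ℕ := 𝒜.coins.eval n

/-- The adversary's coins `r_A` (the first `coins(n)` coins). [folklore] -/
def rAOf (w : List Bool) : List Bool := (sndF w).take (cA 𝒜 (nOf w))

/-- The level bits `a`. [folklore] -/
def aBitsOf (w : List Bool) : List Bool := ((sndF w).drop (cA 𝒜 (nOf w))).take (alphaOf (nOf w))

/-- The slot bits `b`. [folklore] -/
def bBitsOf (w : List Bool) : List Bool :=
  (((sndF w).drop (cA 𝒜 (nOf w))).drop (alphaOf (nOf w))).take (betaOf (tA 𝒜 (nOf w)))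

/-- The block coins `r_F`. [folklore] -/
def rFOf (w : List Bool) : List Bool :=
  (((sndF w).drop (cA 𝒜 (nOf w))).drop (alphaOf (nOf w))).drop (betaOf (tA 𝒜 (nOf w)))

/-- The level `i = min ⟦a⟧ n` (binary value of the level bits, least significant bit first, capped
at `n`: levels `≥ n` are rejected by the guard anyway, and the cap keeps the unary numeral of `i`
short). [Goldreich 2001, p. 188 ("`D` selects uniformly `k ∈ {0, 1, …, n − 1}`")] [folklore] -/
def iOf (w : List Bool) : ℕ := min (bitsToNat (aBitsOf 𝒜 w)) (nOf w)

/-- The slot `j = min ⟦b⟧ t` of the challenge sample (capped at `t`, likewise).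
[Goldreich 2001, Thm. 3.2.6 (p. 140: "`k` uniformly in `{0, …, m−1}`")] [folklore] -/
def jOf (w : List Bool) : ℕ := min (bitsToNat (bBitsOf 𝒜 w)) (tA 𝒜 (nOf w))

/-- The adversary's deterministic input `⟨1ⁿ, r_A⟩`. [Goldreich 2001, p. 188 ("`D` invokes `M` on
input `1ⁿ`")] [folklore] -/
def xAOf (w : List Bool) : List Bool := boolPair (unaryEncodeNat (nOf w)) (rAOf 𝒜 w)

/-- Block `m` of the block coins: `2n` bits. [Goldreich 2001, p. 188 (`α_i ∈ {0,1}²ⁿ`)] [folklore] -/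
def blkL (n : ℕ) (rF : List Bool) (m : ℕ) : List Bool := (rF.drop (2 * n * m)).take (2 * n)

/-- **The value of the vertex first met at round `m`** when the sample sits in slot `j`: block `m`
before the slot, the sample at the slot, `G (block m ↾ n)` after it. [Goldreich 2001, p. 188 with
Thm. 3.2.6 (p. 140)] [folklore] -/
def valL (n j : ℕ) (s rF : List Bool) (m : ℕ) : List Bool :=
  if m < j then blkL n rF m else if m = j then s else G ((blkL n rF m).take n)

/-- Continuing the walk from the two child labels stored in `v` (strings). [Goldreich 2001, p. 188] [folklore] -/
def postPairL (n i : ℕ) (v u : List Bool) : List Bool :=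
  ggmEval G (if u.getD i false then v.drop n else v.take n) (u.drop (i + 1))

/-- **The answer rule of the simulation** on input `w`. [Goldreich 2001, p. 188 (algorithm `D`);
GGM 1986, p. 801 (`A_T`)] [folklore] -/
def simRule (w : List Bool) : Rule :=
  lazyRule 𝒜.alg (xAOf 𝒜 w) (keyAt (nOf w) (iOf 𝒜 w)) (postPairL G (nOf w) (iOf 𝒜 w))
    (valL G (nOf w) (jOf 𝒜 w) (sOf w) (rFOf 𝒜 w))

/-- **The simulation language**: the inputs `w` on which the adversary, run on `⟨1ⁿ, r_A⟩` for
`fuel(n)` rounds against the simulated oracle, outputs `1`. [Goldreich 2001, p. 188 ("when `M`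
halts, algorithm `D` halts as well and outputs the same output as `M`")] [folklore] -/
def simLang : Language Bool :=
  {w | runRule 𝒜.alg (xAOf 𝒜 w) (simRule 𝒜 G w) (tA 𝒜 (nOf w)) [] = some true}

open Classical in
/-- **The verdict of the distinguisher** on `w`: the guard `i < n ∧ j < t` and the simulated run
accepts. [Goldreich 2001, p. 188] [folklore] -/
noncomputable def simAccept (w : List Bool) : Bool :=
  decide (iOf 𝒜 w < nOf w ∧ jOf 𝒜 w < tA 𝒜 (nOf w) ∧ w ∈ simLang 𝒜 G)

/-- The coin budget of the distinguisher on game inputs `⟨1ⁿ, sample⟩` of length `L = 4n + 2`: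
`coins(n) + α + β + 2n·t`. [folklore] -/
def coinLenD (L : ℕ) : ℕ :=
  cA 𝒜 ((L - 2) / 4) + alphaOf ((L - 2) / 4) + betaOf (tA 𝒜 ((L - 2) / 4)) + 2 * ((L - 2) / 4) * tA 𝒜 ((L - 2) / 4)

/-- **The distinguisher `D`** for the generator built from the oracle adversary `𝒜`.
[Goldreich 2001, proof of Thm. 3.6.6 (algorithm `D`, p. 188) with Thm. 3.2.6; GGM 1986, p. 801 (`A_T`)] [folklore] -/
noncomputable def distinguisher : RandAlg (List Bool) Bool where
  run x r := simAccept 𝒜 G (boolPair x r)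
  coinLen := coinLenD 𝒜

/-! ### The parse of a genuine input -/

section Genuine

variable {n : ℕ} {s rA a b rF : List Bool}

/-- `|1ⁿ| = n`. [Mathlib `unary_decode_encode_nat`] [folklore] -/
theorem length_unaryEncodeNat_eq (n : ℕ) : (unaryEncodeNat n).length = n := unary_decode_encode_nat n

/-- A genuine input of the distinguisher: game input `⟨1ⁿ, s⟩` and coins `r_A ‖ a ‖ b ‖ r_F`. [folklore] -/
def genuine (n : ℕ) (s rA a b rF : List Bool) : List Bool :=
  boolPair (boolPair (unaryEncodeNat n) s) (rA ++ a ++ b ++ rF)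

/-- The security parameter of a genuine input. [folklore] -/
@[simp] theorem nOf_genuine : nOf (genuine n s rA a b rF) = n := by
  simp [nOf, genuine, length_unaryEncodeNat_eq]

/-- The sample of a genuine input. [folklore] -/
theorem sOf_genuine (hs : s.length = 2 * n) : sOf (genuine n s rA a b rF) = s := by
  unfold sOf
  rw [nOf_genuine]
  simp [genuine, List.take_of_length_le hs.le]

variable (hrA : rA.length = cA 𝒜 n) (ha : a.length = alphaOf n) (hb : b.length = betaOf (tA 𝒜 n))
include hrA

/-- The adversary's coins of a genuine input. [folklore] -/
theorem rAOf_genuine : rAOf 𝒜 (genuine n s rA a b rF) = rA := by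
  unfold rAOf
  rw [nOf_genuine]
  unfold genuine
  simp only [sndF_boolPair, List.append_assoc]
  exact List.take_left' hrA

/-- The adversary's input of a genuine input. [folklore] -/
theorem xAOf_genuine : xAOf 𝒜 (genuine n s rA a b rF) = boolPair (unaryEncodeNat n) rA := by
  rw [xAOf, nOf_genuine, rAOf_genuine 𝒜 hrA]

include ha

/-- The level bits of a genuine input. [folklore] -/
theorem aBitsOf_genuine : aBitsOf 𝒜 (genuine n s rA a b rF) = a := by
  unfold aBitsOf
  rw [nOf_genuine]
  unfold genuine
  simp only [sndF_boolPair, List.append_assoc]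
  rw [List.drop_left' hrA]
  exact List.take_left' ha

include hb

/-- The slot bits of a genuine input. [folklore] -/
theorem bBitsOf_genuine : bBitsOf 𝒜 (genuine n s rA a b rF) = b := by
  unfold bBitsOf
  rw [nOf_genuine]
  unfold genuine
  simp only [sndF_boolPair, List.append_assoc]
  rw [List.drop_left' hrA, List.drop_left' ha]
  exact List.take_left' hb

/-- The block coins of a genuine input. [folklore] -/
theorem rFOf_genuine : rFOf 𝒜 (genuine n s rA a b rF) = rF := by
  unfold rFOf
  rw [nOf_genuine]
  unfold genuine
  simp only [sndF_boolPair, List.append_assoc]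
  rw [List.drop_left' hrA, List.drop_left' ha, List.drop_left' hb]

/-- The slot of a genuine input. [folklore] -/
theorem jOf_genuine : jOf 𝒜 (genuine n s rA a b rF) = min (bitsToNat b) (tA 𝒜 n) := by
  rw [jOf, bBitsOf_genuine 𝒜 hrA ha hb, nOf_genuine]

omit hb in
/-- The level of a genuine input. [folklore] -/
theorem iOf_genuine : iOf 𝒜 (genuine n s rA a b rF) = min (bitsToNat a) n := by
  rw [iOf, aBitsOf_genuine 𝒜 hrA ha, nOf_genuine]

end Genuine

/-! ### From string values to the vector-valued pools -/

section Pools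

variable (n : ℕ) (hG : ∀ s, (G s).length = 2 * s.length) {t : ℕ}

/-- `postPair` is `postPairL` on the string of the value. [folklore] -/
theorem postPair_eq_postPairL (i : ℕ) (v : List.Vector Bool (2 * n)) (u : List Bool) :
    postPair G n i v u = postPairL G n i v.toList u := by
  unfold postPair postPairL half
  cases u.getD i false <;> rfl

/-- The lazy rule with vector values is the lazy rule with their strings. [folklore] -/
theorem lazyRule_postPair_eq {β : Type} (M : OracleAlg β) (x : List Bool) (i : ℕ)
    (pool : ℕ → List.Vector Bool (2 * n)) :
    lazyRule M x (keyAt n i) (postPair G n i) pool =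
      lazyRule M x (keyAt n i) (postPairL G n i) (fun m => (pool m).toList) := by
  funext E u
  unfold lazyRule
  cases keyAt n i u with
  | none => rfl
  | some κ => simp only [postPair_eq_postPairL]

/-- Blocks of a genuine block string: block `m` of the string is the `m`-th block vector. [folklore] -/
def BlocksOf (rF : List Bool) (blk : Fin t → List.Vector Bool (2 * n)) : Prop :=
  ∀ m : Fin t, (blk m).toList = blkL n rF m

/-- **The string values with a uniform sample are the pool `poolU`** (below the round budget).
[Goldreich 2001, p. 188] [folklore] -/
theorem valL_eq_poolU {rF : List Bool} {blk : Fin t → List.Vector Bool (2 * n)} (hblk : BlocksOf n rF blk)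
    (σ : List.Vector Bool n) (u : List.Vector Bool (2 * n)) (j : ℕ) {m : ℕ} (hm : m < t) :
    valL G n j u.toList rF m = (poolU G n hG t j (blk, σ, u) m).toList := by
  unfold valL poolU
  rw [ext_of_lt _ hm]
  simp only
  split_ifs
  · exact (hblk ⟨m, hm⟩).symm
  · rfl
  · rw [toList_Gvec, toList_fstHalf, hblk ⟨m, hm⟩]

/-- **The string values with a sample `G σ` are the pool `poolG`** (below the round budget).
[Goldreich 2001, p. 188] [folklore] -/
theorem valL_eq_poolG {rF : List Bool} {blk : Fin t → List.Vector Bool (2 * n)} (hblk : BlocksOf n rF blk)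
    (σ : List.Vector Bool n) (u : List.Vector Bool (2 * n)) (j : ℕ) {m : ℕ} (hm : m < t) :
    valL G n j (G σ.toList) rF m = (poolG G n hG t j (blk, σ, u) m).toList := by
  unfold valL poolG
  rw [ext_of_lt _ hm]
  simp only
  split_ifs
  · exact (hblk ⟨m, hm⟩).symm
  · rfl
  · rw [toList_Gvec, toList_fstHalf, hblk ⟨m, hm⟩]

variable {β : Type} (M : OracleAlg β) (x : List Bool)

/-- **The simulated run with a uniform sample is the lazy run with pool `poolU`.** [Goldreich 2001, p. 188] [folklore] -/
theorem runRule_valL_eq_lazyRunPair_poolU {rF : List Bool} {blk : Fin t → List.Vector Bool (2 * n)}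
    (hblk : BlocksOf n rF blk) (σ : List.Vector Bool n) (u : List.Vector Bool (2 * n)) (i j : ℕ) :
    runRule M x (lazyRule M x (keyAt n i) (postPairL G n i) (valL G n j u.toList rF)) t [] =
      lazyRunPair M x G n t i (poolU G n hG t j (blk, σ, u)) := by
  unfold lazyRunPair
  rw [lazyRule_postPair_eq]
  exact runRule_lazyRule_congr M x (keyAt n i) (postPairL G n i) t fun m hm => valL_eq_poolU G n hG hblk σ u j hm

/-- **The simulated run with a sample `G σ` is the lazy run with pool `poolG`.** [Goldreich 2001, p. 188] [folklore] -/
theorem runRule_valL_eq_lazyRunPair_poolG {rF : List Bool} {blk : Fin t → List.Vector Bool (2 * n)}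
    (hblk : BlocksOf n rF blk) (σ : List.Vector Bool n) (u : List.Vector Bool (2 * n)) (i j : ℕ) :
    runRule M x (lazyRule M x (keyAt n i) (postPairL G n i) (valL G n j (G σ.toList) rF)) t [] =
      lazyRunPair M x G n t i (poolG G n hG t j (blk, σ, u)) := by
  unfold lazyRunPair
  rw [lazyRule_postPair_eq]
  exact runRule_lazyRule_congr M x (keyAt n i) (postPairL G n i) t fun m hm => valL_eq_poolG G n hG hblk σ u j hm

end Pools

end GGMHyb

end Literature.Computability.Cryptography
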